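import Literature.Analysis.FluidPDE.ConvexIntegration2DLimit
import Literature.Analysis.FluidPDE.ConvexIntegration2DReduction
import Mathlib.Analysis.Matrix.PosDef
import HarnessLib

/-!
# Convex integration in 2-D: proof of Lemma 3.7 of Chiodaroli–De Lellis–Kreml on a ball

Topic `Analysis/FluidPDE`. Final layer of the discharge of the named facts
`ConvexIntegrationLemma2DBall` (`ConvexIntegration2DReduction.lean`) and, through the
Besicovitch/gluing reduction `convexIntegrationLemma2D_of_ball` of that file,
`ConvexIntegrationLemma2D` (`ConvexIntegration2D.lean`): Chiodaroli–De Lellis–Kreml, CPAM 68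
(2015), Lemma 3.7.

* `exists_small_wave`: a non-trivial localized plane wave `w` inside `X₀` (so small that
  `qt + s w(z) ∈ 𝒰` for `|s| ≤ 1`), used as starting direction and as observable;
* `baseState`, `inU_baseState`: the hypothesis `ṽ ⊗ ṽ - ũ < (C/2) Id` (as `Matrix.PosDef`) in the
  flat coordinates of `ConvexIntegration2DGeometricLemma.lean`;
* `IterData.isCISolution`: the limit of a run of the iteration is an admissible field on `Ω`
  (`IsCISolution`: measurable, `|v|² = C` a.e. on `Ω`, and the two conservation laws in
  `𝒟'(ℝ × ℝ²)` with `u̲ = v ⊗ v - (C/2) Id - u₀`, which is the limit stress a.e. on `Ω` since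
  `M = 0` there);
* `hasWildFamily_ball`: infinitely many pairwise not a.e. equal admissible fields on a ball — the
  runs started at `p₀ = w/(n+1)` with tolerance `θ_n = ‖w_c‖²/(8(n+1)²)` are told apart by the
  observable `∫ v̲_c w_c` (`obs_separation`);
* `ConvexIntegrationLemma2DBall_holds`, `convexIntegrationLemma2D_holds`.

## The proof as formalized (layers `ConvexIntegration2D*.lean`)

CDK prove Lemma 3.7 by the Baire-category method of De Lellis–Székelyhidi: on the weak-* closure
`X` of `X₀` the identity is Baire-1 into `L²`, at its points of continuity (a residual set) the
constraint `|ṽ + v̲|² = C` holds, because of the perturbation property (Cl) built from localized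
plane waves (Prop. 4.1) and the geometric lemma (Lemma 4.3). The formalization keeps Prop. 4.1
(explicit two-dimensional third-order potential, `…Potential`, `…PlaneWaves*`), Lemma 4.3
(explicit, `…GeometricLemma`) and (Cl) (`…Subsolutions`, `…Step`, with a measurable Besicovitch
family of cells), and replaces the category argument by an explicit iteration `p_{k+1} = p_k + w_k`
(`…Iteration*`) whose increments are chosen nearly orthogonal to all previous states: then
`‖p_m - p_n‖²_{L²} ≤ F_m - F_n` for a bounded monotone `F`, the states converge strongly in `L²`
(a.e. along a subsequence, `…Limit`), `∫_Ω (C - |ṽ + v̲_k|²) → 0` by (Cl), and the limit satisfies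
(i)–(iii) of Lemma 3.7.

## References

* E. Chiodaroli, C. De Lellis, O. Kreml, *Global ill-posedness of the isentropic system of gas
  dynamics*, Comm. Pure Appl. Math. 68 (2015) 1157–1190, Lemma 3.7, §4.
* C. De Lellis, L. Székelyhidi Jr., *On admissibility criteria for weak solutions of the Euler
  equations*, Arch. Ration. Mech. Anal. 195 (2010) 225–260.
* S. Markfelder, *Convex Integration Applied to the Multi-Dimensional Compressible Euler
  Equations*, LNM 2294 (2021), Thm 5.3.1.
-/

noncomputable section

open MeasureTheory Set Metric Filter Function
open scoped ContDiff Topology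

namespace Literature.Analysis.FluidPDE.ConvexIntegration

/-! ### A small localized plane wave inside `X₀` -/

/-- **A small wave in `X₀`.** For a strict subsolution `qt` and a ball `B(z₀, R)` there is a
non-trivial localized plane wave `w` (smooth, supported in the ball, solving the linear system,
with positive velocity energy) so small that `qt + s w(z) ∈ 𝒰` for all `|s| ≤ 1` and all `z`
(openness of `𝒰` and CDK Prop. 4.1 (i)). [cite: ChiodaroliDeLellisKreml2015, §4.1 (the space `X₀` is non-trivial)] -/
theorem exists_small_wave {C : ℝ} {qt : State} (hqt : InU C qt) (z₀ : ST) {R : ℝ} (hR : 0 < R) :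
    ∃ w : Fin 4 → ST → ℝ, (∀ c, ContDiff ℝ ∞ (w c)) ∧ (∀ c, HasCompactSupport (w c)) ∧
      (∀ c, tsupport (w c) ⊆ ball z₀ R) ∧ SolvesLinear w ∧
      (∀ s : ℝ, |s| ≤ 1 → ∀ z, InU C (qt + fun c => s * w c z)) ∧
      0 < ∫ z, (w 0 z ^ 2 + w 1 z ^ 2) := by
  -- room around `qt` in the open set `𝒰`
  obtain ⟨ρ, hρ, hball⟩ := Metric.isOpen_iff.mp (isOpen_setOf_inU C) qt hqt
  -- the wave datum: direction `n = e₁`, `μ = 0`, amplitude `ρ/4`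
  set d : WaveData := ⟨z₀, R, hR, !₂[1, 0], by simp, 0, ρ / 4⟩ with hd
  have hD : ∀ i, |d.Dvec i| ≤ 1 := by
    intro i
    fin_cases i
    · show |(!₂[(1 : ℝ), 0] : E2) 0| ≤ 1; simp
    · show |(!₂[(1 : ℝ), 0] : E2) 1| ≤ 1; simp
    · show |2 * (0 : ℝ) * (!₂[(1 : ℝ), 0] : E2) 0 * (!₂[(1 : ℝ), 0] : E2) 1| ≤ 1; simp
    · show |(0 : ℝ) * ((!₂[(1 : ℝ), 0] : E2) 1 ^ 2 - (!₂[(1 : ℝ), 0] : E2) 0 ^ 2)| ≤ 1; simp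
  have hA : d.A = ρ / 4 := rfl
  -- volume of the half ball
  have hV : 0 < volume.real (ball d.c (d.r / 2)) :=
    ENNReal.toReal_pos (measure_ball_pos volume _ (by show 0 < R / 2; linarith)).ne'
      measure_ball_lt_top.ne
  set ε : ℝ := (ρ / 4) ^ 2 / 4 * volume.real (ball d.c (d.r / 2)) with hε
  have hεpos : 0 < ε := by positivity
  obtain ⟨N, hN1, hN2⟩ := ((d.wave_eventually_close (by positivity : (0 : ℝ) < ρ / 4)).and
    (d.wave_energy_eventually hεpos)).exists
  refine ⟨d.wave N, d.contDiff_wave N, d.hasCompactSupport_wave N, d.tsupport_wave_subset N,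
    d.solvesLinear_wave N, fun s hs z => ?_, ?_⟩
  · -- values: `|s wave(z)| ≤ ρ/2 < ρ`
    apply hball
    rw [mem_ball, dist_eq_norm, add_sub_cancel_left, pi_norm_lt_iff hρ]
    intro c
    rw [Real.norm_eq_abs, abs_mul]
    have h1 : |d.wave N c z| ≤ ρ / 2 := by
      have hm : |d.waveMain N c z| ≤ ρ / 4 := by
        simp only [WaveData.waveMain, abs_mul, hA]
        calc |ρ / 4| * |d.cutoff z| * |osc d.η N 3 z| * |d.Dvec c| ≤ |ρ / 4| * 1 * 1 * 1 := by
              gcongr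
              · exact d.abs_cutoff_le_one z
              · exact abs_osc_le_one _ _ _ _
              · exact hD c
          _ = ρ / 4 := by rw [abs_of_pos (by positivity)]; ring
      calc |d.wave N c z| = |(d.wave N c z - d.waveMain N c z) + d.waveMain N c z| := by ring_nf
        _ ≤ |d.wave N c z - d.waveMain N c z| + |d.waveMain N c z| := abs_add_le _ _
        _ ≤ ρ / 4 + ρ / 4 := add_le_add (hN1 c z) hm
        _ = ρ / 2 := by ring
    calc |s| * |d.wave N c z| ≤ 1 * (ρ / 2) := mul_le_mul hs h1 (abs_nonneg _) zero_le_one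
      _ < ρ := by linarith
  · -- energy: `≥ A²/2 |B/2| - ε = A²/4 |B/2| > 0`
    have h3 := (abs_le.mp hN2).1
    have hχ := d.volume_half_ball_le_integral_cutoff_sq
    rw [hA] at h3
    have : (ρ / 4) ^ 2 / 2 * volume.real (ball d.c (d.r / 2)) ≤ (ρ / 4) ^ 2 / 2 * ∫ z, d.cutoff z ^ 2 :=
      mul_le_mul_of_nonneg_left hχ (by positivity)
    nlinarith

/-! ### From the data of Lemma 3.7 to the state space -/

/-- The base state `qt = (ṽ₁, ṽ₂, ũ₁₁, ũ₁₂)` of the data `(v₀, u₀)`. [folklore] -/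
def baseState (v₀ : E2) (u₀ : Matrix (Fin 2) (Fin 2) ℝ) : State := ![v₀ 0, v₀ 1, u₀ 0 0, u₀ 0 1]

/-- **The hypothesis of Lemma 3.7 in coordinates:** for `u₀` symmetric and trace-free,
`(C/2) Id - (v₀ ⊗ v₀ - u₀)` positive definite means `baseState v₀ u₀ ∈ 𝒰`.
[cite: ChiodaroliDeLellisKreml2015, Lemma 3.7 (hypothesis `ṽ ⊗ ṽ - ũ < (C/2) Id`)] -/
theorem inU_baseState {v₀ : E2} {u₀ : Matrix (Fin 2) (Fin 2) ℝ} {C : ℝ} (hsymm : u₀.IsSymm)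
    (htr : u₀.trace = 0)
    (hpos : ((C / 2) • (1 : Matrix (Fin 2) (Fin 2) ℝ) - (Matrix.vecMulVec v₀ v₀ - u₀)).PosDef) :
    InU C (baseState v₀ u₀) := by
  set Mx := (C / 2) • (1 : Matrix (Fin 2) (Fin 2) ℝ) - (Matrix.vecMulVec v₀ v₀ - u₀)
  have h10 : u₀ 1 0 = u₀ 0 1 := by
    have := congrFun (congrFun hsymm 0) 1
    simpa [Matrix.transpose_apply] using this
  have h11 : u₀ 1 1 = -u₀ 0 0 := by
    rw [Matrix.trace_fin_two] at htr; linarith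
  have e00 : Mx 0 0 = C / 2 - v₀ 0 ^ 2 + u₀ 0 0 := by
    simp [Mx, Matrix.vecMulVec_apply]; ring
  have e11 : Mx 1 1 = C / 2 - v₀ 1 ^ 2 - u₀ 0 0 := by
    simp [Mx, Matrix.vecMulVec_apply, h11]; ring
  have e01 : Mx 0 1 = u₀ 0 1 - v₀ 0 * v₀ 1 := by
    simp [Mx, Matrix.vecMulVec_apply]
  have e10 : Mx 1 0 = u₀ 0 1 - v₀ 0 * v₀ 1 := by
    simp [Mx, Matrix.vecMulVec_apply, h10]; ring
  have htrace : 0 < Mx 0 0 + Mx 1 1 := by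
    have h := hpos.trace_pos
    rw [Matrix.trace_fin_two] at h
    exact h
  have hdet : 0 < Mx 0 0 * Mx 1 1 - Mx 0 1 * Mx 1 0 := by
    have h := hpos.det_pos
    rw [Matrix.det_fin_two] at h
    exact h
  rw [e00, e11] at htrace
  rw [e00, e11, e01, e10] at hdet
  refine ⟨?_, ?_⟩
  · simp only [trM, m11, m22, baseState, Matrix.cons_val_zero, Matrix.cons_val_one, Matrix.cons_val]
    linarith
  · simp only [detM, m11, m22, m12, baseState, Matrix.cons_val_zero, Matrix.cons_val_one,
      Matrix.cons_val]
    nlinarith [hdet]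

/-- Coordinates of the base state. [folklore] -/
theorem baseState_apply_zero (v₀ : E2) (u₀ : Matrix (Fin 2) (Fin 2) ℝ) : baseState v₀ u₀ 0 = v₀ 0 := rfl
/-- Coordinates of the base state. [folklore] -/
theorem baseState_apply_one (v₀ : E2) (u₀ : Matrix (Fin 2) (Fin 2) ℝ) : baseState v₀ u₀ 1 = v₀ 1 := rfl
/-- Coordinates of the base state. [folklore] -/
theorem baseState_apply_two (v₀ : E2) (u₀ : Matrix (Fin 2) (Fin 2) ℝ) : baseState v₀ u₀ 2 = u₀ 0 0 := rfl
/-- Coordinates of the base state. [folklore] -/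
theorem baseState_apply_three (v₀ : E2) (u₀ : Matrix (Fin 2) (Fin 2) ℝ) : baseState v₀ u₀ 3 = u₀ 0 1 := rfl

/-! ### The limit of one run of the iteration is an admissible field -/

namespace IterData

variable (d : IterData)

/-- The components of the velocity field `ṽ + v̲` of the limit. [folklore] -/
def velComp (v₀ : E2) : Fin 2 → ST → ℝ := ![fun z => v₀ 0 + d.P 0 z, fun z => v₀ 1 + d.P 1 z]

/-- The velocity field `v = ṽ + v̲` of the limit, as an `ℝ²`-valued map. [folklore] -/
def vel (v₀ : E2) : ST → E2 := fun z => WithLp.toLp 2 fun j => d.velComp v₀ j z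

/-- First component of the velocity field. [folklore] -/
theorem vel_apply_zero (v₀ : E2) (z : ST) : d.vel v₀ z 0 = v₀ 0 + d.P 0 z := by
  simp [vel, velComp]

/-- Second component of the velocity field. [folklore] -/
theorem vel_apply_one (v₀ : E2) (z : ST) : d.vel v₀ z 1 = v₀ 1 + d.P 1 z := by
  simp [vel, velComp]

/-- The velocity field is measurable. [folklore] -/
theorem measurable_vel (v₀ : E2) : Measurable (d.vel v₀) := by
  refine (WithLp.measurable_toLp 2 (Fin 2 → ℝ)).comp (measurable_pi_lambda _ fun j => ?_)
  fin_cases j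
  · exact measurable_const.add (d.measurable_P 0)
  · exact measurable_const.add (d.measurable_P 1)

/-- `|v|² = (ṽ₁ + v̲₁)² + (ṽ₂ + v̲₂)²`. [folklore] -/
theorem norm_sq_vel (v₀ : E2) (z : ST) :
    ‖d.vel v₀ z‖ ^ 2 = (v₀ 0 + d.P 0 z) ^ 2 + (v₀ 1 + d.P 1 z) ^ 2 := by
  rw [EuclideanSpace.norm_eq, Real.sq_sqrt (Finset.sum_nonneg fun i _ => by positivity),
    Fin.sum_univ_two, Real.norm_eq_abs, Real.norm_eq_abs, sq_abs, sq_abs, vel_apply_zero,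
    vel_apply_one]

/-- The entries of `M` vanish a.e. on `Ω` for the limit state (`M ⪰ 0` with zero trace).
[folklore] -/
theorem ae_entries_eq_zero : ∀ᵐ z, z ∈ d.Ω →
    m11 d.C (d.limState z) = 0 ∧ m22 d.C (d.limState z) = 0 ∧ m12 (d.limState z) = 0 := by
  have h1 := (ae_restrict_iff' d.hΩo.measurableSet).mp d.ae_trM_limState_eq_zero
  filter_upwards [h1, d.ae_limit_props] with z hz hz'
  intro hzΩ
  exact hz'.2.2.entries_eq_zero (hz hzΩ)

/-- Components of an `ℝ²`-valued test function are `C¹_c`, and their partial derivatives are the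
components of the Fréchet derivative. [folklore] -/
theorem testFun_component {w : ST → E2} (hw : Literature.Analysis.FunctionSpaces.IsTestFunctionOn ⊤ w)
    (i : Fin 2) : ContDiff ℝ 1 (fun z => w z i) ∧ HasCompactSupport (fun z => w z i) ∧
      ∀ z e, pd e (fun z => w z i) z = fderiv ℝ w z e i := by
  have hL : (fun z => w z i) = (EuclideanSpace.proj i : E2 →L[ℝ] ℝ) ∘ w := by
    funext z; simp
  refine ⟨?_, ?_, fun z e => ?_⟩
  · rw [hL]; exact ((EuclideanSpace.proj i : E2 →L[ℝ] ℝ).contDiff.comp hw.contDiff).of_le one_le_infty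
  · exact hw.hasCompactSupport.comp_left (g := fun x : E2 => x i) rfl
  · rw [pd_apply, hL, ((EuclideanSpace.proj i : E2 →L[ℝ] ℝ).hasFDerivAt.comp z
      ((hw.contDiff.differentiable (by simp)) z).hasFDerivAt).fderiv]
    simp [PiLp.proj_apply]

/-- **The limit of the iteration is an admissible field** on `Ω` for the data `(v₀, u₀, C)`:
measurable, `|v|² = C` a.e. on `Ω`, and the two linear conservation laws in `𝒟'(ℝ × ℝ²)` with
`u̲ = v ⊗ v - (C/2) Id - u₀` (which is the limit stress a.e. on `Ω`, by `M = 0`).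
[cite: ChiodaroliDeLellisKreml2015, Lemma 3.7 (i)–(iii)] -/
theorem isCISolution {v₀ : E2} {u₀ : Matrix (Fin 2) (Fin 2) ℝ} (hqt : d.qt = baseState v₀ u₀)
    (hsymm : u₀.IsSymm) (htr : u₀.trace = 0) : IsCISolution d.Ω v₀ u₀ d.C (d.vel v₀) := by
  have hq0 : d.qt 0 = v₀ 0 := by rw [hqt]; rfl
  have hq1 : d.qt 1 = v₀ 1 := by rw [hqt]; rfl
  have hq2 : d.qt 2 = u₀ 0 0 := by rw [hqt]; rfl
  have hq3 : d.qt 3 = u₀ 0 1 := by rw [hqt]; rfl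
  have h10 : u₀ 1 0 = u₀ 0 1 := by
    have := congrFun (congrFun hsymm 0) 1
    simpa [Matrix.transpose_apply] using this
  have h11 : u₀ 1 1 = -u₀ 0 0 := by
    rw [Matrix.trace_fin_two] at htr; linarith
  refine ⟨d.measurable_vel v₀, ?_, ?_, ?_⟩
  · -- `|v|² = C` a.e. on `Ω`
    filter_upwards [d.ae_trM_limState_eq_zero] with z hz
    rw [trM_eq, limState_apply, limState_apply, hq0, hq1] at hz
    rw [norm_sq_vel]
    linarith
  · -- `div_x v̲ = 0`
    intro φ hφ
    have hφ1 : ContDiff ℝ 1 φ := hφ.contDiff.of_le one_le_infty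
    have hpt : ∀ z, ∑ j, (d.vel v₀ z j - v₀ j) * fderiv ℝ φ z (0, EuclideanSpace.single j 1)
        = d.P 0 z * pd (dX 0) φ z + d.P 1 z * pd (dX 1) φ z := by
      intro z
      rw [Fin.sum_univ_two, vel_apply_zero, vel_apply_one]
      simp only [pd_apply, dX]
      ring
    simp_rw [hpt]
    rw [setIntegral_eq_integral_of_ae_compl_eq_zero]
    · exact d.limit_weak_div hφ1 hφ.hasCompactSupport
    · filter_upwards [d.ae_limit_props] with z hz hzΩ
      simp [hz.2.1 hzΩ]
  · -- `∂_t v̲ + div_x u̲ = 0`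
    intro w hw
    obtain ⟨hw0, hw0c, hpd0⟩ := testFun_component hw 0
    obtain ⟨hw1, hw1c, hpd1⟩ := testFun_component hw 1
    -- the integrand a.e. on `Ω`
    have hpt : ∀ᵐ z, z ∈ d.Ω →
        (∑ i, (d.vel v₀ z i - v₀ i) * fderiv ℝ w z (1, 0) i +
          ∑ i, ∑ j, (d.vel v₀ z i * d.vel v₀ z j - (if i = j then d.C / 2 else 0) - u₀ i j) *
            fderiv ℝ w z (0, EuclideanSpace.single j 1) i)
        = (d.P 0 z * pd dT (fun z => w z 0) z + d.P 2 z * pd (dX 0) (fun z => w z 0) z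
            + d.P 3 z * pd (dX 1) (fun z => w z 0) z)
          + (d.P 1 z * pd dT (fun z => w z 1) z + d.P 3 z * pd (dX 0) (fun z => w z 1) z
            - d.P 2 z * pd (dX 1) (fun z => w z 1) z) := by
      filter_upwards [d.ae_entries_eq_zero] with z hz hzΩ
      obtain ⟨e11, e22, e12⟩ := hz hzΩ
      simp only [m11, m22, m12, limState_apply, hq0, hq1, hq2, hq3] at e11 e22 e12
      rw [Fin.sum_univ_two, Fin.sum_univ_two, Fin.sum_univ_two, Fin.sum_univ_two,
        vel_apply_zero, vel_apply_one, hpd0, hpd0, hpd0, hpd1, hpd1, hpd1]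
      simp only [Fin.isValue, if_true, show ((0 : Fin 2) = 1) = False by decide,
        show ((1 : Fin 2) = 0) = False by decide, if_false, h10, h11, dT, dX]
      linear_combination (-(fderiv ℝ w z (0, EuclideanSpace.single 0 1)) 0) * e11
        + (-(fderiv ℝ w z (0, EuclideanSpace.single 1 1)) 1) * e22
        + (-(fderiv ℝ w z (0, EuclideanSpace.single 1 1)) 0
            - (fderiv ℝ w z (0, EuclideanSpace.single 0 1)) 1) * e12
    rw [setIntegral_congr_ae d.hΩo.measurableSet hpt, setIntegral_eq_integral_of_ae_compl_eq_zero]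
    · have i1 : Integrable (fun z => d.P 0 z * pd dT (fun z => w z 0) z
          + d.P 2 z * pd (dX 0) (fun z => w z 0) z + d.P 3 z * pd (dX 1) (fun z => w z 0) z) := by
        have hi : ∀ e, Integrable (pd e (fun z => w z 0)) := fun e =>
          (continuous_pd hw0 e).integrable_of_hasCompactSupport (hasCompactSupport_pd hw0c e)
        exact ((d.integrable_P_mul 0 (hi _)).add (d.integrable_P_mul 2 (hi _))).add
          (d.integrable_P_mul 3 (hi _))
      have i2 : Integrable (fun z => d.P 1 z * pd dT (fun z => w z 1) z
          + d.P 3 z * pd (dX 0) (fun z => w z 1) z - d.P 2 z * pd (dX 1) (fun z => w z 1) z) := by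
        have hi : ∀ e, Integrable (pd e (fun z => w z 1)) := fun e =>
          (continuous_pd hw1 e).integrable_of_hasCompactSupport (hasCompactSupport_pd hw1c e)
        exact ((d.integrable_P_mul 1 (hi _)).add (d.integrable_P_mul 3 (hi _))).sub
          (d.integrable_P_mul 2 (hi _))
      rw [integral_add i1 i2, d.limit_weak_mom₁ hw0 hw0c, d.limit_weak_mom₂ hw1 hw1c, add_zero]
    · filter_upwards [d.ae_limit_props] with z hz hzΩ
      simp [hz.2.1 hzΩ]

end IterData

/-! ### Infinitely many admissible fields on a ball -/

section Family

variable {v₀ : E2} {u₀ : Matrix (Fin 2) (Fin 2) ℝ} {C : ℝ} {z₀ : ST} {R : ℝ}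

/-- The elementary inequality separating the observables of two runs:
`I/(8(n+1)²) + I/(8(m+1)²) < (1/(n+1) - 1/(m+1)) I` for `n < m`, `I > 0`. [folklore] -/
theorem obs_separation {I : ℝ} (hI : 0 < I) {n m : ℕ} (hnm : n < m) :
    I / (8 * ((n : ℝ) + 1) ^ 2) + I / (8 * ((m : ℝ) + 1) ^ 2)
      < (1 / ((n : ℝ) + 1) - 1 / ((m : ℝ) + 1)) * I := by
  obtain ⟨k, rfl⟩ := Nat.exists_eq_add_of_lt hnm
  set a : ℝ := (n : ℝ) + 1 with ha
  have ha1 : 1 ≤ a := by rw [ha]; have := (Nat.cast_nonneg n : (0 : ℝ) ≤ n); linarith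
  have hk1 : (1 : ℝ) ≤ (k : ℝ) + 1 := by have := (Nat.cast_nonneg k : (0 : ℝ) ≤ k); linarith
  have hb : ((n + k + 1 : ℕ) : ℝ) + 1 = a + (k + 1) := by push_cast; rw [ha]; ring
  rw [hb]
  set j : ℝ := (k : ℝ) + 1 with hj
  have hapos : 0 < a := by linarith
  have hbpos : 0 < a + j := by linarith
  rw [div_add_div _ _ (by positivity) (by positivity), div_sub_div _ _ hapos.ne' hbpos.ne',
    div_mul_eq_mul_div, div_lt_div_iff₀ (by positivity) (by positivity)]
  have key : 0 < 8 * a * (a + j) * j - (a ^ 2 + (a + j) ^ 2) := by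
    nlinarith [mul_le_mul ha1 ha1 zero_le_one hapos.le, mul_le_mul ha1 hk1 zero_le_one hapos.le,
      mul_le_mul hk1 hk1 zero_le_one (by linarith)]
  nlinarith [mul_pos hI key, mul_pos (mul_pos hapos hbpos) hI]

variable (hsymm : u₀.IsSymm) (htr : u₀.trace = 0)
  (hpos : ((C / 2) • (1 : Matrix (Fin 2) (Fin 2) ℝ) - (Matrix.vecMulVec v₀ v₀ - u₀)).PosDef)
  (hR : 0 < R)

/-- **Lemma 3.7 of CDK on a ball: a wild family.** [cite: ChiodaroliDeLellisKreml2015, Lemma 3.7] -/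
theorem hasWildFamily_ball (z₀ : ST) (hsymm : u₀.IsSymm) (htr : u₀.trace = 0) (hC : 0 < C)
    (hpos : ((C / 2) • (1 : Matrix (Fin 2) (Fin 2) ℝ) - (Matrix.vecMulVec v₀ v₀ - u₀)).PosDef)
    (hR : 0 < R) : HasWildFamily (ball z₀ R) v₀ u₀ C := by
  set qt := baseState v₀ u₀ with hqt_def
  have hqt : InU C qt := inU_baseState hsymm htr hpos
  -- the small wave and the observed component
  obtain ⟨ws, hws, hwsc, hwsΩ, hwsol, hwsU, hwsE⟩ := exists_small_wave hqt z₀ hR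
  have hint : ∀ c, Integrable (fun z => ws c z ^ 2) := fun c => by
    simpa [sq] using integrable_mul_of_cs (hws c).continuous (hwsc c) (hws c).continuous
  obtain ⟨cs, hcs, hIg⟩ : ∃ cs : Fin 4, (cs = 0 ∨ cs = 1) ∧ 0 < ∫ z, ws cs z ^ 2 := by
    rw [integral_add (hint 0) (hint 1)] at hwsE
    rcases lt_or_ge 0 (∫ z, ws 0 z ^ 2) with h0 | h0
    · exact ⟨0, Or.inl rfl, h0⟩
    · exact ⟨1, Or.inr rfl, by linarith⟩
  set Ig : ℝ := ∫ z, ws cs z ^ 2 with hIg_def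
  -- the runs of the iteration
  have hmem : ∀ s : ℝ, |s| ≤ 1 → MemX0 C qt (ball z₀ R) (fun c z => s * ws c z) := by
    intro s hs
    refine ⟨fun c => contDiff_const.mul (hws c), fun c => (hwsc c).comp_left (g := fun t => s * t)
      (mul_zero s), fun c => (tsupport_mul_subset_right).trans (hwsΩ c),
      hwsol.const_mul (fun c => differentiable_of_smooth (hws c)) s, fun z => ?_⟩
    exact hwsU s hs z
  set D : ℕ → IterData := fun n =>
    { C := C, qt := qt, Ω := ball z₀ R, p₀ := fun c z => (1 / ((n : ℝ) + 1)) * ws c z, g := ws cs,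
      cobs := cs, θ := Ig / (8 * ((n : ℝ) + 1) ^ 2), hC := hC, hqt := hqt, hΩo := isOpen_ball,
      hΩb := isBounded_ball, hΩne := ⟨z₀, mem_ball_self hR⟩,
      hp₀ := hmem _ (by rw [abs_of_pos (by positivity)]; exact (div_le_one (by positivity)).mpr (by linarith)),
      hg := (hws cs).of_le one_le_infty, hgc := hwsc cs, hθ := by positivity }
  refine ⟨fun n => (D n).vel v₀, fun n m hnm => ?_, fun n => (D n).isCISolution rfl hsymm htr⟩
  -- pairwise distinct: the observable `∫ P_cs g` separates the runs
  intro heq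
  -- the observable of the run `n`: `X n = ∫ P_cs g` with `|X n - Ig/(n+1)| ≤ θ n`
  have hX : ∀ n, |(∫ z, (D n).P cs z * ws cs z) - 1 / ((n : ℝ) + 1) * Ig|
      ≤ Ig / (8 * ((n : ℝ) + 1) ^ 2) := by
    intro n
    have h := (D n).abs_integral_obs_le
    have hgi : Integrable (ws cs) := (hws cs).continuous.integrable_of_hasCompactSupport (hwsc cs)
    have e : (fun z => ((D n).P cs z - 1 / ((n : ℝ) + 1) * ws cs z) * ws cs z)
        = fun z => (D n).P cs z * ws cs z - 1 / ((n : ℝ) + 1) * ws cs z ^ 2 := by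
      funext z; ring
    have h' : |∫ z, ((D n).P cs z * ws cs z - 1 / ((n : ℝ) + 1) * ws cs z ^ 2)|
        ≤ Ig / (8 * ((n : ℝ) + 1) ^ 2) := by
      have := h; simp only [D] at this ⊢; rw [e] at this; exact this
    rwa [integral_sub ((D n).integrable_P_mul cs hgi) ((hint cs).const_mul _), integral_const_mul] at h'
  -- a.e. equality on the ball gives equal observables
  have hXeq : ∫ z, (D n).P cs z * ws cs z = ∫ z, (D m).P cs z * ws cs z := by
    have hsupp : ∀ k : ℕ, ∫ z, (D k).P cs z * ws cs z = ∫ z in ball z₀ R, (D k).P cs z * ws cs z := by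
      intro k
      rw [setIntegral_eq_integral_of_forall_compl_eq_zero]
      intro z hz
      rw [image_eq_zero_of_notMem_tsupport (fun h => hz (hwsΩ cs h)), mul_zero]
    rw [hsupp n, hsupp m]
    refine integral_congr_ae ?_
    have hcomp : ∀ᵐ z ∂(volume.restrict (ball z₀ R)), (D n).P cs z = (D m).P cs z := by
      filter_upwards [heq] with z hz
      rcases hcs with hc | hc
      · have h0 := congrArg (fun x : E2 => x 0) hz
        simp only [IterData.vel_apply_zero] at h0
        rw [hc]; linarith
      · have h1 := congrArg (fun x : E2 => x 1) hz
        simp only [IterData.vel_apply_one] at h1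
        rw [hc]; linarith
    filter_upwards [hcomp] with z hz
    rw [hz]
  -- contradiction with the separation inequality
  have hn := hX n
  have hm := hX m
  rw [hXeq] at hn
  have hdiff : |1 / ((n : ℝ) + 1) * Ig - 1 / ((m : ℝ) + 1) * Ig|
      ≤ Ig / (8 * ((n : ℝ) + 1) ^ 2) + Ig / (8 * ((m : ℝ) + 1) ^ 2) := by
    calc _ = |((∫ z, (D m).P cs z * ws cs z) - 1 / ((m : ℝ) + 1) * Ig)
          - ((∫ z, (D m).P cs z * ws cs z) - 1 / ((n : ℝ) + 1) * Ig)| := by ring_nf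
      _ ≤ |(∫ z, (D m).P cs z * ws cs z) - 1 / ((m : ℝ) + 1) * Ig|
          + |(∫ z, (D m).P cs z * ws cs z) - 1 / ((n : ℝ) + 1) * Ig| := abs_sub _ _
      _ ≤ _ := by linarith
  rcases lt_or_gt_of_ne hnm with h | h
  · have hs := obs_separation hIg h
    rw [← sub_mul, abs_mul, abs_of_pos hIg, abs_of_pos (by
      rw [sub_pos, one_div_lt_one_div (by positivity) (by positivity)]; exact_mod_cast Nat.succ_lt_succ h)] at hdiff
    linarith
  · have hs := obs_separation hIg h
    rw [← sub_mul, abs_mul, abs_of_pos hIg, abs_sub_comm, abs_of_pos (by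
      rw [sub_pos, one_div_lt_one_div (by positivity) (by positivity)]; exact_mod_cast Nat.succ_lt_succ h)] at hdiff
    linarith

end Family

/-! ### The named facts -/

/-- **Lemma 3.7 of Chiodaroli–De Lellis–Kreml on a ball (cylinder), proved.** Discharge of
the named fact `ConvexIntegrationLemma2DBall`: for every ball `B((t₀, x₀), r)` of `ℝ × ℝ²`
(product metric), every `v₀`, symmetric trace-free `u₀` and `C > 0` with
`(C/2) Id - (v₀ ⊗ v₀ - u₀)` positive definite, the ball carries infinitely many (pairwise not
a.e. equal) admissible velocity fields. The proof is the constructive form of CDK §4: an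
explicit iteration `p_{k+1} = p_k + w_k` in `X₀` by finite sums of localized plane waves
(Prop. 4.1) along the segments of the geometric lemma (Lemma 4.3) on Besicovitch families of
cells, with frequencies chosen so large that the increments are nearly orthogonal to the past;
`∫_Ω (C - |ṽ + v̲_k|²) → 0` by the perturbation property (Cl), the states converge strongly in
`L²` (in place of the Baire-category argument), and the limit satisfies (i)–(iii); infinitely
many limits are told apart by their pairing with a fixed small wave.
[cite: ChiodaroliDeLellisKreml2015, Lemma 3.7 and §4] -/
theorem ConvexIntegrationLemma2DBall_holds : ConvexIntegrationLemma2DBall := by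
  intro z₀ r hr v₀ u₀ C hsymm htr hC hpos
  exact hasWildFamily_ball z₀ hsymm htr hC hpos hr

/-- **Lemma 3.7 of Chiodaroli–De Lellis–Kreml (= Markfelder 2021, Thm 5.3.1 for constant
two-dimensional subsolutions), proved:** discharge of the named fact `ConvexIntegrationLemma2D`
for arbitrary non-empty open `Ω ⊆ ℝ × ℝ²`, from the ball case by the Besicovitch/gluing
reduction `convexIntegrationLemma2D_of_ball`. [cite: ChiodaroliDeLellisKreml2015, Lemma 3.7] -/
theorem convexIntegrationLemma2D_holds : ConvexIntegrationLemma2D :=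
  convexIntegrationLemma2D_of_ball ConvexIntegrationLemma2DBall_holds

end Literature.Analysis.FluidPDE.ConvexIntegration

namespace Literature.Analysis.FluidPDE.ConvexIntegration

/-- **`ConvexIntegrationLemma2D` is a theorem of the tree (audit alias).** The named fact
`ConvexIntegrationLemma2D` (`ConvexIntegration2D.lean`): Convex-integration lemma for the 2-D
linearised pressureless Euler system (Chiodaroli–De Lellis–Kreml 2015, Lemma 3.7; = Markfelder
2021, Thm 5.3.1 for constant two-dimensional subsolutions). … — is proved, with exactly this
statement, by `convexIntegrationLemma2D_holds` (this file); this alias records the discharge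
under the census/audit name `ConvexIntegrationLemma2D_holds` (librarian sweep g25, pass 5c; no
new mathematics).
[cite: ChiodaroliDeLellisKreml2015, Lemma 3.7]
[cite: Markfelder2021, Thm 5.3.1 with Thm 5.1.2 (a)–(c)] -/
theorem ConvexIntegrationLemma2D_holds :
    ConvexIntegrationLemma2D :=
  Literature.Analysis.FluidPDE.ConvexIntegration.convexIntegrationLemma2D_holds

end Literature.Analysis.FluidPDE.ConvexIntegration
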